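/-
Copyright (c) 2026 the pub-hodgecm-mathlib formalisation cell (harness21).  Prover seat hodgecm-mathlib-K2E3-p11 (g7), Track B «K2-LIT» ∕ h413
(`stmt-HodgeConjecture-24833`), line `K2_E3_EllipticInputs`, road (11-3-split-nsc), leaf (nsc-S-A′) `sig_K2E3GL3PrincipalBlockStandardSpan` (architect K2E3-p25 (g2),
`MEMO-SA-architecture.v2` §3), case brick C2 «CUBE» (support `{a, aν, aν²}`), FILE C2a: THE STANDARD MODULES OF THE CUBE AND THEIR EMBEDDINGS
`π₁ ↪ D ↪ I`, `D′ ↪ I′`, `π₁ ↪ I`.  2026-09-04.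
-/
import Summits.HodgeConjecture.HodgeConjecture.Theorems.K2E3GL3StandardModuleEmbedding   -- ★ STD-EMB (K2E3-p03): `D η ψ ↪ I ![ην½⁻¹, ην½, ψ]`, `det_leviProjection_false_mul_true`, `coe_nuHalf_apply`, `coe_sqrt_eq_cpow_half`, `normAbs_cpow_half_mul_self`, `isAdmissible_D`; brings ★ ONE-DIM
import Summits.HodgeConjecture.HodgeConjecture.Theorems.K2E3GL2UnlinkedIrreducible       -- ★ GL2-UNL (this seat): `coe_unramifiedTwist_one` (`ν t = ‖t‖`)
import HarnessLib

/-!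
# K2_E3 road (h413), leaf (nsc-S-A′), case brick C2 «cube» — file C2a: the standard modules `π₁ = (aν)∘det`, `D = D(aν^{1∕2}, aν²)`, `D′ = D(aν^{3∕2}, a)` of the
# cube `I = I(a, aν, aν²)` and the embeddings `π₁ ↪ D ↪ I`, `D′ ↪ I′ = I(aν, aν², a)`, `π₁ ↪ I`

Cell `pub/hodgecm-mathlib` (D-0151), Track B, seat K2E3-p11 (g7); architect K2E3-p25 (g2) (C2 «=» by name 11:14:58Z).  `--supports stmt-HodgeConjecture-24833 --as helper`;
THEOREMS ONLY (no definition ∕ instance ∕ notation ∕ named fact ∕ `sorry`); never imports `Cruxes/…/Lines`.  COUNT-NEUTRAL helper.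

NOTATION (spelled out inline; CONVENTIONS 08:40Z + MEMO v2 §0–§1).  `ν := (unramifiedTwist F 1).toMonoidHom`, `ν½ := (unramifiedTwist F (1/2)).toMonoidHom`;
`tch θ := ∏ t, (θ t) ∘ det ∘ ev_t`, `I θ := parabolicIndGL F id (𝟙.twist (tch θ))`; the CUBE at `a : F^× →* ℂ^×`: `θ_cube := ![a, aν, aν²]`, `I := I θ_cube`, `I′ := I ![aν, aν², a]`;
`π₁ := (trivial ℂ (GL (Fin 3) F) ℂ).twist ((aν) ∘ det)` (★ ONE-DIM `ρ_η` at `η := aν`); `ψ_Q η ψ := (η ∘ det ∘ ev_false) * (ψ ∘ det ∘ ev_true)` on the Levi `M_Q` of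
`Q := P₂₁ = standardParabolicGL F ![false,false,true]`, `D η ψ := parabolicIndGL F ![false,false,true] (𝟙.twist (ψ_Q η ψ))` (★ STD-EMB); the cube's standard modules
`D := D (aν½) (aν²)`, `D′ := D (aν ν½) a`.

THE MATHEMATICS [Zelevinsky1980, §1.1, Ex. 3.2, Prop. 2.10, Thm. 4.2, §9]; [BernsteinZelevinsky1977, 1.7, Prop. 1.9, §2.3, Thm. 2.5]; [Rodier1982, §5 (the representations of `GL₃`)].
* §1 character algebra: `ν½ · ν½ = ν`, the three letter identities identifying the STD-EMB ∕ ONE-DIM parameter triples with `θ_cube` and `![aν, aν², a]`, and `ν^k ≠ 1`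
  (`ν(ϖ) = ‖ϖ‖ < 1`) — so the letters `a, aν, aν²` are pairwise distinct and `a`, `aν²` are NOT linked.
* §2 **`D ↪ I`, `D′ ↪ I′`** (★ STD-EMB `exists_injective_not_surjective_intertwiningMap` at `(η, ψ) = (aν½, aν²)` resp. `(aν ν½, a)`) and **`π₁ ↪ I`** (★ ONE-DIM at `η = aν`:
  `θ_{aν} = ![aν·ν⁻¹, aν, aν·ν] = θ_cube`).
* §3 **`π₁ ↪ D`**: on `Q` the inducing datum of `D` is the character `(aν) ∘ det` — `δ_Q^{1∕2}(q) · (aν½)(det A) (aν²)(λ) = ‖A‖^{1∕2}‖λ‖⁻¹ · a(A)‖A‖^{1∕2} · a(λ)‖λ‖² = (aν)(det q)`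
  (`q = (A *; 0 λ)`, ★ `rootDeltaChar_standardParabolicGL_bool`, ★ `det_leviProjection_false_mul_true`) — so the identity `ℂ → ℂ` is a `Q`-map and Frobenius reciprocity
  (★ `Representation.frobeniusInv`) embeds `π₁` into `D`, injectively (evaluation at `1`), exactly as ★ ONE-DIM §4 did for `B`.
HONEST LABEL: HC_CM is proved only modulo the 7 printed citations (2 remaining named inputs: hLiu418 = stmt-HodgeConjecture-24832, h413 = stmt-HodgeConjecture-24833)
until rung 0 closes; count-neutral helper (representation theory of `GL₃(F)`; no printed citation is discharged).

## Mathlib ∕ tree search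
Tree ★: STD-EMB `exists_injective_not_surjective_intertwiningMap`∕`det_leviProjection_false_mul_true`∕`coe_nuHalf_apply`∕`coe_sqrt_eq_cpow_half`∕`normAbs_cpow_half_mul_self`∕`isAdmissible_D`∕`isOpen_ker_psiQ` ·
ONE-DIM `exists_injective_intertwiningMap_twist_det`∕`finrank_weightSpace_twist_det`∕`isAdmissible_twist_det`∕`twist_det_apply`∕`isOpen_ker_comp_det` · GL2-UNL `coe_unramifiedTwist_one` ·
`rootDeltaChar_standardParabolicGL_bool` (GLnMaximalParabolicLocalModulus) · `Representation.frobeniusInv`∕`toFun_frobeniusInv_apply` · `unramifiedTwist_apply`, `normAbs_lt_one_iff`, `exists_valuation_pos_lt_one`.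
Mathlib: `Complex.cpow_add`∕`cpow_one`∕`cpow_natCast`, `LinearMap.intertwiningMap_of_isIntertwiningMap`.  Dedup: `rg "CubeStandardModules|theta_cube|nuHalf_mul_nuHalf"` — none.

## References
* [Zelevinsky1980] A. V. Zelevinsky, *Induced representations of reductive p-adic groups II*, Ann. Sci. ÉNS 13 (1980), §1.1, Prop. 2.10, Ex. 3.2, Thm. 4.2.
* [BernsteinZelevinsky1977] I. N. Bernstein, A. V. Zelevinsky, *Induced representations of reductive p-adic groups I*, Ann. Sci. ÉNS 10 (1977), 1.7, Prop. 1.9, §2.3, Thm. 2.5.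
* [Rodier1982] F. Rodier, *Représentations de GL(n, k) où k est un corps p-adique*, Sém. Bourbaki 587 (1982), §5.
-/

set_option autoImplicit false
-- the mandated namespace repeats the single-problem summit's segment (`HodgeConjecture.HodgeConjecture`)
set_option linter.dupNamespace false

noncomputable section

open Module Matrix
open scoped MatrixGroups NNReal
open Literature.NumberTheory.Automorphic ValuativeRel
open Literature.NumberTheory.GaloisRepresentations Literature.NumberTheory.GaloisRepresentations.IsNonarchimedeanLocalField
open Summit.HodgeConjecture.HodgeConjecture.Cruxes.H413.K2E3GL3StandardModuleEmbedding
open Summit.HodgeConjecture.HodgeConjecture.Cruxes.H413.K2E3GL3CharacterJacquetExponent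
open Summit.HodgeConjecture.HodgeConjecture.Cruxes.H413.K2E3GL2UnlinkedIrreducible

namespace Summit.HodgeConjecture.HodgeConjecture.Cruxes.H413.K2E3GL3CubeStandardModules

variable {F : Type} [Field F] [ValuativeRel F] [TopologicalSpace F] [IsNonarchimedeanLocalField F]

/-! ## §1 Character algebra: `ν½ ν½ = ν`, the letter identities, `ν^k ≠ 1` -/

/-- **`ν^{1∕2} · ν^{1∕2} = ν`** in the commutative group `F^× →* ℂ^×` (`‖t‖^{1∕2} ‖t‖^{1∕2} = ‖t‖`). [cite: Zelevinsky1980, §1.1] -/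
theorem nuHalf_mul_nuHalf : ((unramifiedTwist F (1 / 2) : QuasiChar F).toMonoidHom) * ((unramifiedTwist F (1 / 2) : QuasiChar F).toMonoidHom) = ((unramifiedTwist F 1 : QuasiChar F).toMonoidHom) := by
  ext t
  rw [MonoidHom.mul_apply, Units.val_mul, coe_nuHalf_apply, coe_unramifiedTwist_one, normAbs_cpow_half_mul_self]

/-- `x · ν½ · ν½⁻¹ = x` (pointwise in `ℂ^×`). [cite: Zelevinsky1980, §1.1] -/
theorem mul_nuHalf_mul_nuHalf_inv (x : Fˣ →* ℂˣ) : x * ((unramifiedTwist F (1 / 2) : QuasiChar F).toMonoidHom) * ((unramifiedTwist F (1 / 2) : QuasiChar F).toMonoidHom)⁻¹ = x :=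
  MonoidHom.ext fun t => by rw [MonoidHom.mul_apply, MonoidHom.mul_apply, MonoidHom.inv_apply, mul_inv_cancel_right]

/-- `x · ν½ · ν½ = x · ν`. [cite: Zelevinsky1980, §1.1] -/
theorem mul_nuHalf_mul_nuHalf (x : Fˣ →* ℂˣ) : x * ((unramifiedTwist F (1 / 2) : QuasiChar F).toMonoidHom) * ((unramifiedTwist F (1 / 2) : QuasiChar F).toMonoidHom) = x * ((unramifiedTwist F 1 : QuasiChar F).toMonoidHom) :=
  MonoidHom.ext fun t => by
    rw [MonoidHom.mul_apply, MonoidHom.mul_apply, MonoidHom.mul_apply, mul_assoc, ← MonoidHom.mul_apply ((unramifiedTwist F (1 / 2) : QuasiChar F).toMonoidHom) ((unramifiedTwist F (1 / 2) : QuasiChar F).toMonoidHom) t, nuHalf_mul_nuHalf]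

/-- `x · ν · ν⁻¹ = x`. [cite: Zelevinsky1980, §1.1] -/
theorem mul_nu_mul_nu_inv (x : Fˣ →* ℂˣ) : x * ((unramifiedTwist F 1 : QuasiChar F).toMonoidHom) * ((unramifiedTwist F 1 : QuasiChar F).toMonoidHom)⁻¹ = x :=
  MonoidHom.ext fun t => by rw [MonoidHom.mul_apply, MonoidHom.mul_apply, MonoidHom.inv_apply, mul_inv_cancel_right]

/-- The STD-EMB parameter triple of `D = D(aν½, aν²)` IS the cube: `![(aν½)ν½⁻¹, (aν½)ν½, aν²] = ![a, aν, aν²]`. [cite: Zelevinsky1980, Ex. 3.2] -/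
theorem theta_D_eq (a : Fˣ →* ℂˣ) :
    (![a * ((unramifiedTwist F (1 / 2) : QuasiChar F).toMonoidHom) * ((unramifiedTwist F (1 / 2) : QuasiChar F).toMonoidHom)⁻¹, a * ((unramifiedTwist F (1 / 2) : QuasiChar F).toMonoidHom) * ((unramifiedTwist F (1 / 2) : QuasiChar F).toMonoidHom), a * ((unramifiedTwist F 1 : QuasiChar F).toMonoidHom) * ((unramifiedTwist F 1 : QuasiChar F).toMonoidHom)] : Fin 3 → (Fˣ →* ℂˣ)) =
      ![a, a * ((unramifiedTwist F 1 : QuasiChar F).toMonoidHom), a * ((unramifiedTwist F 1 : QuasiChar F).toMonoidHom) * ((unramifiedTwist F 1 : QuasiChar F).toMonoidHom)] := by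
  rw [mul_nuHalf_mul_nuHalf_inv, mul_nuHalf_mul_nuHalf]

/-- The STD-EMB parameter triple of `D′ = D(aν·ν½, a)` is `![aν, aν², a]`. [cite: Zelevinsky1980, Ex. 3.2] -/
theorem theta_D'_eq (a : Fˣ →* ℂˣ) :
    (![a * ((unramifiedTwist F 1 : QuasiChar F).toMonoidHom) * ((unramifiedTwist F (1 / 2) : QuasiChar F).toMonoidHom) * ((unramifiedTwist F (1 / 2) : QuasiChar F).toMonoidHom)⁻¹, a * ((unramifiedTwist F 1 : QuasiChar F).toMonoidHom) * ((unramifiedTwist F (1 / 2) : QuasiChar F).toMonoidHom) * ((unramifiedTwist F (1 / 2) : QuasiChar F).toMonoidHom), a] : Fin 3 → (Fˣ →* ℂˣ)) =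
      ![a * ((unramifiedTwist F 1 : QuasiChar F).toMonoidHom), a * ((unramifiedTwist F 1 : QuasiChar F).toMonoidHom) * ((unramifiedTwist F 1 : QuasiChar F).toMonoidHom), a] := by
  rw [mul_nuHalf_mul_nuHalf_inv, mul_nuHalf_mul_nuHalf]

/-- The ONE-DIM parameter triple of `π₁ = (aν)∘det` IS the cube: `![(aν)ν⁻¹, aν, (aν)ν] = ![a, aν, aν²]`. [cite: Zelevinsky1980, Ex. 3.2] -/
theorem theta_pi_eq (a : Fˣ →* ℂˣ) :
    (![a * ((unramifiedTwist F 1 : QuasiChar F).toMonoidHom) * ((unramifiedTwist F 1 : QuasiChar F).toMonoidHom)⁻¹, a * ((unramifiedTwist F 1 : QuasiChar F).toMonoidHom), a * ((unramifiedTwist F 1 : QuasiChar F).toMonoidHom) * ((unramifiedTwist F 1 : QuasiChar F).toMonoidHom)] : Fin 3 → (Fˣ →* ℂˣ)) = ![a, a * ((unramifiedTwist F 1 : QuasiChar F).toMonoidHom), a * ((unramifiedTwist F 1 : QuasiChar F).toMonoidHom) * ((unramifiedTwist F 1 : QuasiChar F).toMonoidHom)] := by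
  rw [mul_nu_mul_nu_inv]

/-- **The letters of the cube are distinct and `a`, `aν²` are not linked**: an equality `a·ν^k = a·ν^l` of products evaluates at `ϖ` (`0 < ‖ϖ‖ < 1`) to
`‖ϖ‖^k = ‖ϖ‖^l`, so `k = l`.  Stated for the four instances used: `aν ≠ a`, `aν² ≠ a`, `aν² ≠ aν`, `aν³ ≠ a`. [cite: Zelevinsky1980, §4.2, §9] -/
theorem cube_letters_ne (a : Fˣ →* ℂˣ) :
    a * ((unramifiedTwist F 1 : QuasiChar F).toMonoidHom) ≠ a ∧ a * ((unramifiedTwist F 1 : QuasiChar F).toMonoidHom) * ((unramifiedTwist F 1 : QuasiChar F).toMonoidHom) ≠ a ∧ a * ((unramifiedTwist F 1 : QuasiChar F).toMonoidHom) * ((unramifiedTwist F 1 : QuasiChar F).toMonoidHom) ≠ a * ((unramifiedTwist F 1 : QuasiChar F).toMonoidHom) ∧ a * ((unramifiedTwist F 1 : QuasiChar F).toMonoidHom) * ((unramifiedTwist F 1 : QuasiChar F).toMonoidHom) * ((unramifiedTwist F 1 : QuasiChar F).toMonoidHom) ≠ a := by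
  obtain ⟨ϖ, hϖ0, hϖ1⟩ := exists_valuation_pos_lt_one (F := F)
  have hlt : ((normAbs F ϖ : ℝ≥0) : ℝ) < 1 := by exact_mod_cast (normAbs_lt_one_iff.2 hϖ1)
  have hpos : 0 < ((normAbs F ϖ : ℝ≥0) : ℝ) := by
    have h := normAbs_units_ne_zero (Units.mk0 ϖ ((Valuation.ne_zero_iff _).1 hϖ0))
    rw [Units.val_mk0] at h
    exact_mod_cast h.bot_lt
  -- `‖ϖ‖^k = ‖ϖ‖^l → k = l`
  have hinj : ∀ {k l : ℕ}, (((normAbs F ϖ : ℝ≥0) : ℝ) : ℂ) ^ k = (((normAbs F ϖ : ℝ≥0) : ℝ) : ℂ) ^ l → k = l := by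
    intro k l h
    have h' : ((normAbs F ϖ : ℝ≥0) : ℝ) ^ k = ((normAbs F ϖ : ℝ≥0) : ℝ) ^ l := by exact_mod_cast h
    exact pow_right_injective₀ hpos hlt.ne h'
  have hau : ((a (Units.mk0 ϖ ((Valuation.ne_zero_iff _).1 hϖ0)) : ℂˣ) : ℂ) ≠ 0 := Units.ne_zero _
  -- evaluate an identity of characters at `ϖ`
  have key : ∀ (x y : Fˣ →* ℂˣ), x = y →
      ((x (Units.mk0 ϖ ((Valuation.ne_zero_iff _).1 hϖ0)) : ℂˣ) : ℂ) = ((y (Units.mk0 ϖ ((Valuation.ne_zero_iff _).1 hϖ0)) : ℂˣ) : ℂ) :=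
    fun x y h => by rw [h]
  refine ⟨fun h => ?_, fun h => ?_, fun h => ?_, fun h => ?_⟩ <;>
    (have h1 := key _ _ h
     simp only [MonoidHom.mul_apply, Units.val_mul, coe_unramifiedTwist_one, Units.val_mk0] at h1)
  · have : (((normAbs F ϖ : ℝ≥0) : ℝ) : ℂ) ^ 1 = (((normAbs F ϖ : ℝ≥0) : ℝ) : ℂ) ^ 0 := by
      rw [pow_one, pow_zero]; exact mul_left_cancel₀ hau (by rw [mul_one]; exact h1)
    exact absurd (hinj this) (by norm_num)
  · have : (((normAbs F ϖ : ℝ≥0) : ℝ) : ℂ) ^ 2 = (((normAbs F ϖ : ℝ≥0) : ℝ) : ℂ) ^ 0 := by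
      rw [pow_zero, sq]; exact mul_left_cancel₀ hau (by rw [mul_one, ← mul_assoc]; exact h1)
    exact absurd (hinj this) (by norm_num)
  · have : (((normAbs F ϖ : ℝ≥0) : ℝ) : ℂ) ^ 2 = (((normAbs F ϖ : ℝ≥0) : ℝ) : ℂ) ^ 1 := by
      rw [pow_one, sq]; exact mul_left_cancel₀ hau (by rw [← mul_assoc]; exact h1)
    exact absurd (hinj this) (by norm_num)
  · have : (((normAbs F ϖ : ℝ≥0) : ℝ) : ℂ) ^ 3 = (((normAbs F ϖ : ℝ≥0) : ℝ) : ℂ) ^ 0 := by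
      rw [pow_zero, pow_succ, sq]; exact mul_left_cancel₀ hau (by rw [mul_one, ← mul_assoc, ← mul_assoc]; exact h1)
    exact absurd (hinj this) (by norm_num)

/-- `ker ν` is open (`ν = ν½ · ν½` and ★ `isOpen_ker_nuHalf`). [cite: Zelevinsky1980, §1.1] -/
theorem isOpen_ker_nuOne : IsOpen (((((unramifiedTwist F 1 : QuasiChar F).toMonoidHom)).ker : Subgroup Fˣ) : Set Fˣ) := by
  rw [← nuHalf_mul_nuHalf]
  exact isOpen_ker_mul_of_isOpen isOpen_ker_nuHalf isOpen_ker_nuHalf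


/-! ## §2 The embeddings `D ↪ I`, `D′ ↪ I′`, `π₁ ↪ I` (★ STD-EMB, ★ ONE-DIM at the cube's parameters) -/

/-- **`D = D(aν^{1∕2}, aν²) ↪ I = I(a, aν, aν²)`**, injectively (★ STD-EMB at `(η, ψ) = (aν½, aν²)`, parameters identified by `theta_D_eq`).
[cite: Zelevinsky1980, Prop. 2.10, Ex. 3.2] [cite: BernsteinZelevinsky1977, Prop. 1.9] -/
theorem exists_injective_intertwiningMap_D (a : Fˣ →* ℂˣ) (ha : IsOpen ((a.ker : Subgroup Fˣ) : Set Fˣ)) :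
    ∃ Φ : Representation.IntertwiningMap (Representation.parabolicIndGL F (![false, false, true] : Fin 3 → Bool) ((Representation.trivial ℂ (Π t : Bool, GL {i : Fin 3 // (![false, false, true] : Fin 3 → Bool) i = t} F) ℂ).twist (((a * ((unramifiedTwist F (1 / 2) : QuasiChar F).toMonoidHom))).comp ((Matrix.GeneralLinearGroup.det : GL {i : Fin 3 // (![false, false, true] : Fin 3 → Bool) i = false} F →* Fˣ).comp (Pi.evalMonoidHom (fun t : Bool => GL {i : Fin 3 // (![false, false, true] : Fin 3 → Bool) i = t} F) false)) * ((a * ((unramifiedTwist F 1 : QuasiChar F).toMonoidHom) * ((unramifiedTwist F 1 : QuasiChar F).toMonoidHom))).comp ((Matrix.GeneralLinearGroup.det : GL {i : Fin 3 // (![false, false, true] : Fin 3 → Bool) i = true} F →* Fˣ).comp (Pi.evalMonoidHom (fun t : Bool => GL {i : Fin 3 // (![false, false, true] : Fin 3 → Bool) i = t} F) true))))) (Representation.parabolicIndGL F (id : Fin 3 → Fin 3) ((Representation.trivial ℂ (Π t : Fin 3, GL {i : Fin 3 // (id : Fin 3 → Fin 3) i = t} F) ℂ).twist (∏ t : Fin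 3, ((![a, a * ((unramifiedTwist F 1 : QuasiChar F).toMonoidHom), a * ((unramifiedTwist F 1 : QuasiChar F).toMonoidHom) * ((unramifiedTwist F 1 : QuasiChar F).toMonoidHom)] : Fin 3 → (Fˣ →* ℂˣ)) t).comp ((Matrix.GeneralLinearGroup.det : GL {i : Fin 3 // (id : Fin 3 → Fin 3) i = t} F →* Fˣ).comp (Pi.evalMonoidHom (fun b : Fin 3 => GL {i : Fin 3 // (id : Fin 3 → Fin 3) i = b} F) t))))), Function.Injective Φ := by
  have hη : IsOpen (((a * ((unramifiedTwist F (1 / 2) : QuasiChar F).toMonoidHom)).ker : Subgroup Fˣ) : Set Fˣ) := isOpen_ker_mul_of_isOpen ha isOpen_ker_nuHalf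
  have hψ : IsOpen (((a * ((unramifiedTwist F 1 : QuasiChar F).toMonoidHom) * ((unramifiedTwist F 1 : QuasiChar F).toMonoidHom)).ker : Subgroup Fˣ) : Set Fˣ) :=
    isOpen_ker_mul_of_isOpen (isOpen_ker_mul_of_isOpen ha isOpen_ker_nuOne) isOpen_ker_nuOne
  have h := exists_injective_not_surjective_intertwiningMap (a * ((unramifiedTwist F (1 / 2) : QuasiChar F).toMonoidHom)) (a * ((unramifiedTwist F 1 : QuasiChar F).toMonoidHom) * ((unramifiedTwist F 1 : QuasiChar F).toMonoidHom)) hη hψ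
  rw [theta_D_eq] at h
  obtain ⟨Φ, hinj, -, -⟩ := h
  exact ⟨Φ, hinj⟩


/-- **`D′ = D(aν·ν^{1∕2}, a) ↪ I′ = I(aν, aν², a)`**, injectively (★ STD-EMB at `(η, ψ) = (aν ν½, a)`, `theta_D'_eq`). [cite: Zelevinsky1980, Prop. 2.10, Ex. 3.2] -/
theorem exists_injective_intertwiningMap_D' (a : Fˣ →* ℂˣ) (ha : IsOpen ((a.ker : Subgroup Fˣ) : Set Fˣ)) :
    ∃ Φ : Representation.IntertwiningMap (Representation.parabolicIndGL F (![false, false, true] : Fin 3 → Bool) ((Representation.trivial ℂ (Π t : Bool, GL {i : Fin 3 // (![false, false, true] : Fin 3 → Bool) i = t} F) ℂ).twist (((a * ((unramifiedTwist F 1 : QuasiChar F).toMonoidHom) * ((unramifiedTwist F (1 / 2) : QuasiChar F).toMonoidHom))).comp ((Matrix.GeneralLinearGroup.det : GL {i : Fin 3 // (![false, false, true] : Fin 3 → Bool) i = false} F →* Fˣ).comp (Pi.evalMonoidHom (fun t : Bool => GL {i : Fin 3 // (![false, false, true] : Fin 3 → Bool) i = t} F) false)) * (a).comp ((Matrix.GeneralLinearGroup.det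 : GL {i : Fin 3 // (![false, false, true] : Fin 3 → Bool) i = true} F →* Fˣ).comp (Pi.evalMonoidHom (fun t : Bool => GL {i : Fin 3 // (![false, false, true] : Fin 3 → Bool) i = t} F) true))))) (Representation.parabolicIndGL F (id : Fin 3 → Fin 3) ((Representation.trivial ℂ (Π t : Fin 3, GL {i : Fin 3 // (id : Fin 3 → Fin 3) i = t} F) ℂ).twist (∏ t : Fin 3, ((![a * ((unramifiedTwist F 1 : QuasiChar F).toMonoidHom), a * ((unramifiedTwist F 1 : QuasiChar F).toMonoidHom) * ((unramifiedTwist F 1 : QuasiChar F).toMonoidHom), a] : Fin 3 → (Fˣ →* ℂˣ)) t).comp ((Matrix.GeneralLinearGroup.det : GL {i : Fin 3 // (id : Fin 3 → Fin 3) i = t} F →* Fˣ).comp (Pi.evalMonoidHom (fun b : Fin 3 => GL {i : Fin 3 // (id : Fin 3 → Fin 3) i = b} F) t))))), Function.Injective Φ := by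
  have hη : IsOpen (((a * ((unramifiedTwist F 1 : QuasiChar F).toMonoidHom) * ((unramifiedTwist F (1 / 2) : QuasiChar F).toMonoidHom)).ker : Subgroup Fˣ) : Set Fˣ) :=
    isOpen_ker_mul_of_isOpen (isOpen_ker_mul_of_isOpen ha isOpen_ker_nuOne) isOpen_ker_nuHalf
  have h := exists_injective_not_surjective_intertwiningMap (a * ((unramifiedTwist F 1 : QuasiChar F).toMonoidHom) * ((unramifiedTwist F (1 / 2) : QuasiChar F).toMonoidHom)) a hη ha
  rw [theta_D'_eq] at h
  obtain ⟨Φ, hinj, -, -⟩ := h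
  exact ⟨Φ, hinj⟩

/-- **`π₁ = (aν)∘det ↪ I = I(a, aν, aν²)`**, injectively (★ ONE-DIM `exists_injective_intertwiningMap_twist_det` at `η = aν`, `theta_pi_eq`).
[cite: Zelevinsky1980, Ex. 3.2] [cite: BernsteinZelevinsky1977, Thm. 2.5] -/
theorem exists_injective_intertwiningMap_pi_I (a : Fˣ →* ℂˣ) (ha : IsOpen ((a.ker : Subgroup Fˣ) : Set Fˣ)) :
    ∃ Φ : Representation.IntertwiningMap ((Representation.trivial ℂ (GL (Fin 3) F) ℂ).twist ((a * ((unramifiedTwist F 1 : QuasiChar F).toMonoidHom)).comp (Matrix.GeneralLinearGroup.det : GL (Fin 3) F →* Fˣ))) (Representation.parabolicIndGL F (id : Fin 3 → Fin 3) ((Representation.trivial ℂ (Π t : Fin 3, GL {i : Fin 3 // (id : Fin 3 → Fin 3) i = t} F) ℂ).twist (∏ t : Fin 3, ((![a, a * ((unramifiedTwist F 1 : QuasiChar F).toMonoidHom), a * ((unramifiedTwist F 1 : QuasiChar F).toMonoidHom) * ((unramifiedTwist F 1 : QuasiChar F).toMonoidHom)] : Fin 3 → (Fˣ →* ℂˣ))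 t).comp ((Matrix.GeneralLinearGroup.det : GL {i : Fin 3 // (id : Fin 3 → Fin 3) i = t} F →* Fˣ).comp (Pi.evalMonoidHom (fun b : Fin 3 => GL {i : Fin 3 // (id : Fin 3 → Fin 3) i = b} F) t))))), Function.Injective Φ := by
  have h := exists_injective_intertwiningMap_twist_det (a * ((unramifiedTwist F 1 : QuasiChar F).toMonoidHom)) (isOpen_ker_mul_of_isOpen ha isOpen_ker_nuOne)
  rw [theta_pi_eq] at h
  exact h

/-! ## §3 `π₁ ↪ D`: on `Q = P₂₁` the inducing datum of `D` is the character `(aν) ∘ det` -/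

/-- **THE INDUCING CHARACTER OF `D` IS `(aν)∘det` ON `Q`**: `δ_Q^{1∕2}(q) · (aν½)(det A)·(aν²)(λ) = (aν)(det q)` for `q = (A *; 0 λ) ∈ P₂₁`
(`δ_Q^{1∕2}(q) = ‖det A‖^{1∕2}‖λ‖⁻¹` ★ `rootDeltaChar_standardParabolicGL_bool`; `det q = det A · λ` ★ `det_leviProjection_false_mul_true`). [cite: BernsteinZelevinsky1977, 1.7, §2.3] [cite: Zelevinsky1980, Ex. 3.2] -/
theorem rootDeltaChar_mul_psiQ_eq (a : Fˣ →* ℂˣ) (q : ↥(standardParabolicGL F (![false, false, true] : Fin 3 → Bool))) :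
    rootDeltaChar (standardParabolicGL F (![false, false, true] : Fin 3 → Bool)) q * (((a * ((unramifiedTwist F (1 / 2) : QuasiChar F).toMonoidHom))).comp ((Matrix.GeneralLinearGroup.det : GL {i : Fin 3 // (![false, false, true] : Fin 3 → Bool) i = false} F →* Fˣ).comp (Pi.evalMonoidHom (fun t : Bool => GL {i : Fin 3 // (![false, false, true] : Fin 3 → Bool) i = t} F) false)) * ((a * ((unramifiedTwist F 1 : QuasiChar F).toMonoidHom) * ((unramifiedTwist F 1 : QuasiChar F).toMonoidHom))).comp ((Matrix.GeneralLinearGroup.det : GL {i : Fin 3 // (![false, false, true] : Fin 3 → Bool) i = true} F →* Fˣ).comp (Pi.evalMonoidHom (fun t : Bool => GL {i : Fin 3 // (![false, false, true] : Fin 3 → Bool) i = t} F) true))) (leviProjection F (![false, false, true] : Fin 3 → Bool) q) =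
      (a * ((unramifiedTwist F 1 : QuasiChar F).toMonoidHom)) (Matrix.GeneralLinearGroup.det (q : GL (Fin 3) F)) := by
  apply Units.ext
  have hcard1 : Fintype.card {i : Fin 3 // (![false, false, true] : Fin 3 → Bool) i = true} = 1 := by decide
  have hcard2 : Fintype.card {i : Fin 3 // (![false, false, true] : Fin 3 → Bool) i = false} = 2 := by decide
  have hA := normAbs_units_ne_zero (Matrix.GeneralLinearGroup.det (leviProjection F (![false, false, true] : Fin 3 → Bool) q false))
  have hl := normAbs_units_ne_zero (Matrix.GeneralLinearGroup.det (leviProjection F (![false, false, true] : Fin 3 → Bool) q true))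
  rw [← det_leviProjection_false_mul_true q, Units.val_mul, rootDeltaChar_standardParabolicGL_bool, hcard1, hcard2]
  simp only [MonoidHom.mul_apply, MonoidHom.coe_comp, Function.comp_apply, Pi.evalMonoidHom_apply, Units.val_mul, map_mul, coe_nuHalf_apply,
    coe_unramifiedTwist_one, ← coe_sqrt_eq_cpow_half, pow_one, NNReal.sqrt_mul, NNReal.sqrt_inv, NNReal.sqrt_sq, NNReal.coe_mul, NNReal.coe_inv,
    Complex.ofReal_mul, Complex.ofReal_inv]
  have hsA : NNReal.sqrt (normAbs F ((Matrix.GeneralLinearGroup.det (leviProjection F (![false, false, true] : Fin 3 → Bool) q false) : Fˣ) : F)) ≠ 0 :=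
    fun h => hA (by simpa using congrArg (fun r => r * r) h)
  generalize hs : NNReal.sqrt (normAbs F ((Matrix.GeneralLinearGroup.det (leviProjection F (![false, false, true] : Fin 3 → Bool) q false) : Fˣ) : F)) = sA at hsA ⊢
  rw [show normAbs F ((Matrix.GeneralLinearGroup.det (leviProjection F (![false, false, true] : Fin 3 → Bool) q false) : Fˣ) : F) = sA * sA by
    rw [← hs, NNReal.mul_self_sqrt]]
  have hsA' : ((sA : ℝ) : ℂ) ≠ 0 := by exact_mod_cast hsA
  have hl' : (((normAbs F ((Matrix.GeneralLinearGroup.det (leviProjection F (![false, false, true] : Fin 3 → Bool) q true) : Fˣ) : F)) : ℝ) : ℂ) ≠ 0 := by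
    exact_mod_cast hl
  push_cast
  field_simp

/-- **`π₁ = (aν)∘det ↪ D = D(aν^{1∕2}, aν²)`**, injectively: the identity `ℂ → ℂ` is a `Q`-map `π₁|_Q → σ_D` (`rootDeltaChar_mul_psiQ_eq`) and Frobenius reciprocity
(★ `Representation.frobeniusInv`, `(Φ z)(g) = (aν)(det g) z`) turns it into a `GL₃(F)`-embedding. [cite: BernsteinZelevinsky1977, Thm. 2.5, §2.3] [cite: Zelevinsky1980, Prop. 2.10, Ex. 3.2] -/
theorem exists_injective_intertwiningMap_pi_D (a : Fˣ →* ℂˣ) (ha : IsOpen ((a.ker : Subgroup Fˣ) : Set Fˣ)) :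
    ∃ Φ : Representation.IntertwiningMap ((Representation.trivial ℂ (GL (Fin 3) F) ℂ).twist ((a * ((unramifiedTwist F 1 : QuasiChar F).toMonoidHom)).comp (Matrix.GeneralLinearGroup.det : GL (Fin 3) F →* Fˣ))) (Representation.parabolicIndGL F (![false, false, true] : Fin 3 → Bool) ((Representation.trivial ℂ (Π t : Bool, GL {i : Fin 3 // (![false, false, true] : Fin 3 → Bool) i = t} F) ℂ).twist (((a * ((unramifiedTwist F (1 / 2) : QuasiChar F).toMonoidHom))).comp ((Matrix.GeneralLinearGroup.det : GL {i : Fin 3 // (![false, false, true] : Fin 3 → Bool) i = false} F →* Fˣ).comp (Pi.evalMonoidHom (fun t : Bool => GL {i : Fin 3 // (![false, false, true] : Fin 3 → Bool) i = t} F) false)) * ((a * ((unramifiedTwist F 1 : QuasiChar F).toMonoidHom) * ((unramifiedTwist F 1 : QuasiChar F).toMonoidHom))).comp ((Matrix.GeneralLinearGroup.det : GL {i : Fin 3 // (![false, false, true] : Fin 3 → Bool) i = true} F →* Fˣ).comp (Pi.evalMonoidHom (fun t : Bool => GL {i : Fin 3 // (![false, false, true] : Fin 3 → Bool) i = t} F)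 true))))), Function.Injective Φ := by
  have hsm : Representation.IsSmooth ((Representation.trivial ℂ (GL (Fin 3) F) ℂ).twist ((a * ((unramifiedTwist F 1 : QuasiChar F).toMonoidHom)).comp (Matrix.GeneralLinearGroup.det : GL (Fin 3) F →* Fˣ))) := (isAdmissible_twist_det (a * ((unramifiedTwist F 1 : QuasiChar F).toMonoidHom)) (isOpen_ker_mul_of_isOpen ha isOpen_ker_nuOne)).1
  have hφ : ∀ (q : ↥(standardParabolicGL F (![false, false, true] : Fin 3 → Bool))) (z : ℂ),
      (LinearMap.id : ℂ →ₗ[ℂ] ℂ) ((((Representation.trivial ℂ (GL (Fin 3) F) ℂ).twist ((a * ((unramifiedTwist F 1 : QuasiChar F).toMonoidHom)).comp (Matrix.GeneralLinearGroup.det : GL (Fin 3) F →* Fˣ)))).comp (standardParabolicGL F (![false, false, true] : Fin 3 → Bool)).subtype q z) = (Representation.twist ((((Representation.trivial ℂ (Π t : Bool, GL {i : Fin 3 // (![false, false, true] : Fin 3 → Bool) i = t} F) ℂ).twist (((a * ((unramifiedTwist F (1 / 2) : QuasiChar F).toMonoidHom))).comp ((Matrix.GeneralLinearGroup.det : GL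 {i : Fin 3 // (![false, false, true] : Fin 3 → Bool) i = false} F →* Fˣ).comp (Pi.evalMonoidHom (fun t : Bool => GL {i : Fin 3 // (![false, false, true] : Fin 3 → Bool) i = t} F) false)) * ((a * ((unramifiedTwist F 1 : QuasiChar F).toMonoidHom) * ((unramifiedTwist F 1 : QuasiChar F).toMonoidHom))).comp ((Matrix.GeneralLinearGroup.det : GL {i : Fin 3 // (![false, false, true] : Fin 3 → Bool) i = true} F →* Fˣ).comp (Pi.evalMonoidHom (fun t : Bool => GL {i : Fin 3 // (![false, false, true] : Fin 3 → Bool) i = t} F) true))))).comp (leviProjection F (![false, false, true] : Fin 3 → Bool))) (rootDeltaChar (standardParabolicGL F (![false, false, true] : Fin 3 → Bool)))) q ((LinearMap.id : ℂ →ₗ[ℂ] ℂ) z) := by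
    intro q z
    rw [LinearMap.id_apply, LinearMap.id_apply, MonoidHom.comp_apply, Subgroup.coe_subtype, twist_det_apply, Representation.twist_apply,
      MonoidHom.comp_apply, Representation.twist_apply, Representation.trivial_apply, smul_eq_mul, smul_eq_mul, ← mul_assoc,
      ← Units.val_mul, rootDeltaChar_mul_psiQ_eq a q]
  let φ : Representation.IntertwiningMap ((((Representation.trivial ℂ (GL (Fin 3) F) ℂ).twist ((a * ((unramifiedTwist F 1 : QuasiChar F).toMonoidHom)).comp (Matrix.GeneralLinearGroup.det : GL (Fin 3) F →* Fˣ)))).comp (standardParabolicGL F (![false, false, true] : Fin 3 → Bool)).subtype) (Representation.twist ((((Representation.trivial ℂ (Π t : Bool, GL {i : Fin 3 // (![false, false, true] : Fin 3 → Bool) i = t} F) ℂ).twist (((a * ((unramifiedTwist F (1 / 2) : QuasiChar F).toMonoidHom))).comp ((Matrix.GeneralLinearGroup.det : GL {i : Fin 3 // (![false, false, true] : Fin 3 → Bool) i = false} F →* Fˣ).comp (Pi.evalMonoidHom (fun t : Bool => GL {i : Fin 3 // (![false, false, true] : Fin 3 → Bool) i = t} F) false)) * ((a * ((unramifiedTwist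 F 1 : QuasiChar F).toMonoidHom) * ((unramifiedTwist F 1 : QuasiChar F).toMonoidHom))).comp ((Matrix.GeneralLinearGroup.det : GL {i : Fin 3 // (![false, false, true] : Fin 3 → Bool) i = true} F →* Fˣ).comp (Pi.evalMonoidHom (fun t : Bool => GL {i : Fin 3 // (![false, false, true] : Fin 3 → Bool) i = t} F) true))))).comp (leviProjection F (![false, false, true] : Fin 3 → Bool))) (rootDeltaChar (standardParabolicGL F (![false, false, true] : Fin 3 → Bool)))) :=
    LinearMap.intertwiningMap_of_isIntertwiningMap _ _ _ hφ
  have hev : ∀ v : ℂ, (Representation.frobeniusInv hsm φ v).toFun 1 = v := fun v => by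
    rw [Representation.toFun_frobeniusInv_apply, map_one, Module.End.one_apply]
    rfl
  refine ⟨Representation.frobeniusInv hsm φ, fun v w hvw => ?_⟩
  have h := congrArg (fun f => Representation.SmoothInd.toFun f 1) hvw
  exact (hev v).symm.trans (h.trans (hev w))

end Summit.HodgeConjecture.HodgeConjecture.Cruxes.H413.K2E3GL3CubeStandardModules

end
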